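import Literature.NumberTheory.Automorphic.UnitaryGroupDoubledSiegelBruhat
import Literature.NumberTheory.Automorphic.UnitaryGroupSplitPlace
import HarnessLib

/-!
# Characters of `GL_{ι ⊕ ι}` trivial on the Siegel parabolic `P_Δ`; `P_Δ` under inverse-transpose

Topic `NumberTheory/Automorphic`; namespace `Literature.NumberTheory.Automorphic.DoubledUnitary.GLBlock`.  KERNEL only:
proved theorems and four small definitions (`blockSwap`, `LSum`, `cE₁`, `cE₂`), no named fact, no `sorry`.

For the doubled index type `ι ⊕ ι` and the Siegel condition `P_Δ = {g ∣ DoubledUnitary.IsSiegelReindex e g}` («`g` stabilises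
the diagonal `Δ`», GR-2's `IsSiegelDelta`; in block form `LSum X : X₁₁ + X₁₂ = X₂₁ + X₂₂`, i.e. `(C⁻¹ X C)₂₁ = 0` for
`C = (1 0; 1 1)`):

* `hom_eq_one_of_blockTriangular` — a homomorphism `θ : GL_{ι⊕ι}(K) →* A` (`K` a field, `A` commutative) trivial on the
  block-upper- and the block-lower-triangular matrices is trivial (Mathlib's transvection decomposition of `GL`; the block
  swap is a product of three block-unipotents); `hom_eq_one_of_isSiegelReindex` — the same in `P_Δ` form: `θ` trivial on `P_Δ`
  is trivial (`P_Δ = C · (block-upper) · C⁻¹`, and a `P_Δ`-conjugate contains `C · (block-lower) · C⁻¹`).  This is the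
  SPLIT-PLACE engine of [GelbartRogawski1991, §3.1 Prop. 3.1.1 p. 455 L1–2] ∕ [Kudla1994, §3]: at a place of `L⁺` split in `L`
  the doubled unitary group is `GL_{2n}` and `P_Δ` a proper parabolic subgroup, whose normal closure is everything;
* `LSum.of_mul_eq_one` — `P_Δ` is closed under inverses over any commutative ring; `LSum.transpose_diag_conj` —
  `Y ↦ ((S ⊕ −S) Y (S' ⊕ −S'))ᵀ` preserves `P_Δ`; whence **`isSiegelReindex_contragredient_conj`**: for
  `J = reindex e e (S ⊕ −S)` with `S` symmetric invertible and `g ∈ P_Δ`, the contragredient-conjugate `((J g J⁻¹)⁻¹)ᵀ ∈ P_Δ` —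
  the shape of the `c⁻¹w`-component of a point of `U(J)` at a split place (`UnitaryGroupSplitPlace`);
* `isSiegelReindex_one`, `isSiegelReindex_of_map_family` — `1 ∈ P_Δ`; the Siegel condition may be checked after a jointly
  injective family of ring maps (it is a system of linear equations in the entries).

## References

* S. Gelbart, J. Rogawski, *L-functions and Fourier–Jacobi coefficients for the unitary group U(3)*, Invent. Math. 105
  (1991) 445–472, §3.1 Prop. 3.1.1. [GelbartRogawski1991]
* S. Kudla, *Splitting metaplectic covers of dual reductive pairs*, Israel J. Math. 87 (1994) 361–401, §3. [Kudla1994]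
* E. Artin, *Geometric Algebra* (Interscience 1957; Wiley Classics 1988), Chap. IV Thm. 4.6. [Artin1988]

## Provenance

pub-hodgecm2 cell (COR-CM, Hodge ladder stage 2), seat s2crux-idea-2 (DIRECT-CONSTRUCTION lens, finding #4): the linear
algebra under the uniqueness of the doubled Weil representation (`GelbartRogawski1991/DoubledWeilRepresentationUniqueness`).
Everything here is kernel-checked; no named facts.  HC_CM is NOT proved here or anywhere in the tree.
Filed for the tree by the seat `pub-hodgecm-mc-theta-3` at the lead-acknowledged path
`Automorphic/UnitaryGroupDoubledSiegelSplitCharacters.lean` from the author's packet rev 3 (b9d7d85731f5); filer's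
delta = matrix bookkeeping made `private`, cite tags on the public declarations; statements and proofs unchanged.
-/

set_option autoImplicit false

-- `open Matrix` at TOP LEVEL: inside `namespace Literature.NumberTheory.Automorphic.…` it would resolve to the
-- tree namespace `Literature.NumberTheory.Automorphic.Matrix` instead of `_root_.Matrix`.
open Matrix
open Literature.NumberTheory.Automorphic

namespace Literature.NumberTheory.Automorphic.DoubledUnitary.GLBlock


/-! ## §0 split engine (block-upper-triangular matrices detect characters of `GL_{ι ⊕ ι}(K)`) -/

section Engine

variable {K : Type*} [Field K] {ι : Type*} [Fintype ι] [DecidableEq ι] {A : Type*} [CommGroup A]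

/-- the block swap `w = (0 1; 1 0) ∈ GL_{ι ⊕ ι}(K)` (an involution). [folklore] -/
private def blockSwap : GL (ι ⊕ ι) K :=
  ⟨fromBlocks 0 1 1 0, fromBlocks 0 1 1 0, by simp [fromBlocks_multiply], by simp [fromBlocks_multiply]⟩

/-- bookkeeping (`blockSwap_conj_val`). [folklore] -/
private theorem blockSwap_conj_val (g : Matrix (ι ⊕ ι) (ι ⊕ ι) K) :
    fromBlocks (0 : Matrix ι ι K) 1 1 0 * g * fromBlocks (0 : Matrix ι ι K) 1 1 0 =
      fromBlocks g.toBlocks₂₂ g.toBlocks₂₁ g.toBlocks₁₂ g.toBlocks₁₁ := by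
  conv_lhs => rw [← fromBlocks_toBlocks g]
  simp [fromBlocks_multiply]

/-- **Block-triangular matrices detect characters of `GL_{ι ⊕ ι}(K)`** (every invertible matrix is a product of
transvections and a diagonal matrix — Mathlib's `diagonal_transvection_induction_of_det_ne_zero`; a lower block
transvection is conjugate to an upper one by the block swap). [cite: Artin1988, Chap. IV Thm. 4.6] -/
theorem hom_eq_one_of_blockTriangular (θ : GL (ι ⊕ ι) K →* A)
    (hP : ∀ g : GL (ι ⊕ ι) K, (g : Matrix (ι ⊕ ι) (ι ⊕ ι) K).toBlocks₂₁ = 0 → θ g = 1) : θ = 1 := by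
  classical
  have hL : ∀ g : GL (ι ⊕ ι) K, (g : Matrix (ι ⊕ ι) (ι ⊕ ι) K).toBlocks₁₂ = 0 → θ g = 1 := by
    intro g hg
    have h1 : θ (blockSwap * g * blockSwap) = 1 := by
      refine hP _ ?_
      have hval : ((blockSwap * g * blockSwap : GL (ι ⊕ ι) K) : Matrix (ι ⊕ ι) (ι ⊕ ι) K) =
          fromBlocks (g : Matrix (ι ⊕ ι) (ι ⊕ ι) K).toBlocks₂₂ (g : Matrix (ι ⊕ ι) (ι ⊕ ι) K).toBlocks₂₁
            (g : Matrix (ι ⊕ ι) (ι ⊕ ι) K).toBlocks₁₂ (g : Matrix (ι ⊕ ι) (ι ⊕ ι) K).toBlocks₁₁ := by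
        simp only [Units.val_mul, blockSwap]
        exact blockSwap_conj_val _
      rw [hval, hg]
      ext i j
      simp [toBlocks₂₁]
    have hww : (blockSwap : GL (ι ⊕ ι) K) * blockSwap = 1 := Units.ext (by simp [blockSwap, fromBlocks_multiply])
    have hθw : θ blockSwap * θ blockSwap = 1 := by rw [← map_mul, hww, map_one]
    rw [map_mul, map_mul, mul_right_comm, hθw, one_mul] at h1
    exact h1
  refine MonoidHom.ext fun g => ?_
  suffices H : ∀ M : Matrix (ι ⊕ ι) (ι ⊕ ι) K, M.det ≠ 0 →
      ∀ g : GL (ι ⊕ ι) K, (g : Matrix (ι ⊕ ι) (ι ⊕ ι) K) = M → θ g = 1 from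
    H _ (Matrix.GeneralLinearGroup.det_ne_zero g) g rfl
  intro M hM
  refine diagonal_transvection_induction_of_det_ne_zero
    (fun M => ∀ g : GL (ι ⊕ ι) K, (g : Matrix (ι ⊕ ι) (ι ⊕ ι) K) = M → θ g = 1) M hM ?_ ?_ ?_
  · intro D _ g hg
    refine hP g ?_
    ext i j
    simp [toBlocks₂₁, hg, diagonal_apply_ne]
  · rintro ⟨i, j, hij, c⟩ g hg
    rcases i with i | i <;> rcases j with j | j
    · exact hP g (by ext a b; simp [toBlocks₂₁, hg, transvection, Matrix.single])
    · exact hP g (by ext a b; simp [toBlocks₂₁, hg, transvection, Matrix.single])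
    · exact hL g (by ext a b; simp [toBlocks₁₂, hg, transvection, Matrix.single])
    · exact hP g (by ext a b; simp [toBlocks₂₁, hg, transvection, Matrix.single])
  · intro A' B hA hB PA PB g hg
    have hgAB : g = Matrix.GeneralLinearGroup.mkOfDetNeZero A' hA * Matrix.GeneralLinearGroup.mkOfDetNeZero B hB :=
      Units.ext (by simpa [Matrix.GeneralLinearGroup.mkOfDetNeZero] using hg)
    rw [hgAB, map_mul, PA _ (by simp [Matrix.GeneralLinearGroup.mkOfDetNeZero]),
      PB _ (by simp [Matrix.GeneralLinearGroup.mkOfDetNeZero]), one_mul]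

end Engine

/-! ## §A the Siegel condition over a commutative ring -/

section CommRing

variable {R : Type*} [CommRing R] {ι : Type*} [Fintype ι] [DecidableEq ι]

/-- **the Siegel condition** `X₁₁ + X₁₂ = X₂₁ + X₂₂` (`X` stabilises the diagonal `Δ`; the parabolic `P_Δ` of the
doubled space in block form, verbatim the shape of `DoubledUnitary.IsSiegelReindex`). [cite: HarrisKudlaSweet1996, §1 (1.11)] -/
def LSum (X : Matrix (ι ⊕ ι) (ι ⊕ ι) R) : Prop :=
  X.toBlocks₁₁ + X.toBlocks₁₂ = X.toBlocks₂₁ + X.toBlocks₂₂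

/-- `C⁻¹ = (1 0; −1 1)`. [folklore] -/
private def cE₁ : Matrix (ι ⊕ ι) (ι ⊕ ι) R := fromBlocks 1 0 (-1) 1
/-- `C = (1 0; 1 1)` (`C (u, 0) = (u, u)`). [folklore] -/
private def cE₂ : Matrix (ι ⊕ ι) (ι ⊕ ι) R := fromBlocks 1 0 1 1

/-- bookkeeping (`cE₁_mul_cE₂`). [folklore] -/
private theorem cE₁_mul_cE₂ : (cE₁ : Matrix (ι ⊕ ι) (ι ⊕ ι) R) * cE₂ = 1 := by
  simp [cE₁, cE₂, fromBlocks_multiply, ← fromBlocks_one]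

/-- bookkeeping (`cE₂_mul_cE₁`). [folklore] -/
private theorem cE₂_mul_cE₁ : (cE₂ : Matrix (ι ⊕ ι) (ι ⊕ ι) R) * cE₁ = 1 := by
  simp [cE₁, cE₂, fromBlocks_multiply, ← fromBlocks_one]

/-- bookkeeping (`conj_toBlocks₂₁`). [folklore] -/
private theorem conj_toBlocks₂₁ (X : Matrix (ι ⊕ ι) (ι ⊕ ι) R) :
    (cE₁ * X * cE₂).toBlocks₂₁ = (X.toBlocks₂₁ + X.toBlocks₂₂) - (X.toBlocks₁₁ + X.toBlocks₁₂) := by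
  conv_lhs => rw [← fromBlocks_toBlocks X]
  simp only [cE₁, cE₂, fromBlocks_multiply, toBlocks_fromBlocks₂₁, Matrix.one_mul, Matrix.mul_one, Matrix.zero_mul,
    Matrix.mul_zero, Matrix.neg_mul, zero_add, add_zero]
  abel

/-- bookkeeping (`lsum_iff_conj`). [folklore] -/
private theorem lsum_iff_conj (X : Matrix (ι ⊕ ι) (ι ⊕ ι) R) : LSum X ↔ (cE₁ * X * cE₂).toBlocks₂₁ = 0 := by
  rw [conj_toBlocks₂₁, sub_eq_zero, eq_comm]
  rfl

/-- bookkeeping (`conj_mul`). [folklore] -/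
private theorem conj_mul (X Y : Matrix (ι ⊕ ι) (ι ⊕ ι) R) :
    cE₁ * (X * Y) * cE₂ = (cE₁ * X * cE₂) * (cE₁ * Y * cE₂) := by
  rw [show cE₁ * X * cE₂ * (cE₁ * Y * cE₂) = cE₁ * X * (cE₂ * cE₁) * Y * cE₂ by simp only [Matrix.mul_assoc],
    cE₂_mul_cE₁, Matrix.mul_one]
  simp only [Matrix.mul_assoc]

/-- **`P_Δ` is closed under inverses** (over any commutative ring; determinant argument). [cite: HarrisKudlaSweet1996, §1 (1.11)] -/
theorem LSum.of_mul_eq_one {X Y : Matrix (ι ⊕ ι) (ι ⊕ ι) R} (hXY : X * Y = 1) (hX : LSum X) : LSum Y := by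
  set X' := cE₁ * X * cE₂ with hX'
  set Y' := cE₁ * Y * cE₂ with hY'
  have hXY' : X' * Y' = 1 := by rw [hX', hY', ← conj_mul, hXY, Matrix.mul_one, cE₁_mul_cE₂]
  have hX21 : X'.toBlocks₂₁ = 0 := (lsum_iff_conj X).1 hX
  have hXu : IsUnit X'.det := by
    have h : IsUnit (X' * Y').det := by rw [hXY', Matrix.det_one]; exact isUnit_one
    rw [Matrix.det_mul] at h
    exact isUnit_of_mul_isUnit_left h
  have hXblocks : X' = Matrix.fromBlocks X'.toBlocks₁₁ X'.toBlocks₁₂ 0 X'.toBlocks₂₂ := by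
    conv_lhs => rw [← Matrix.fromBlocks_toBlocks X', hX21]
  have hD : IsUnit X'.toBlocks₂₂.det := by
    rw [hXblocks, Matrix.det_fromBlocks_zero₂₁] at hXu
    exact isUnit_of_mul_isUnit_right hXu
  have h21 : X'.toBlocks₂₂ * Y'.toBlocks₂₁ = 0 := by
    have h := congrArg Matrix.toBlocks₂₁ hXY'
    rw [hXblocks, ← Matrix.fromBlocks_toBlocks Y', Matrix.fromBlocks_multiply, Matrix.toBlocks_fromBlocks₂₁,
      Matrix.zero_mul, zero_add] at h
    rw [h, ← Matrix.fromBlocks_one, Matrix.toBlocks_fromBlocks₂₁]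
  refine (lsum_iff_conj Y).2 ?_
  calc Y'.toBlocks₂₁ = X'.toBlocks₂₂⁻¹ * (X'.toBlocks₂₂ * Y'.toBlocks₂₁) := by
        rw [← Matrix.mul_assoc, Matrix.nonsing_inv_mul _ hD, Matrix.one_mul]
    _ = 0 := by rw [h21, Matrix.mul_zero]

omit [DecidableEq ι] in
/-- **`Y ↦ ((S ⊕ −S) Y (S' ⊕ −S'))ᵀ` preserves `P_Δ`** (no invertibility needed). [cite: HarrisKudlaSweet1996, §1 (1.11)] -/
theorem LSum.transpose_diag_conj (S S' : Matrix ι ι R) {Y : Matrix (ι ⊕ ι) (ι ⊕ ι) R} (hY : LSum Y) :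
    LSum ((fromBlocks S 0 0 (-S) * Y * fromBlocks S' 0 0 (-S'))ᵀ) := by
  have h' : Y.toBlocks₁₁ - Y.toBlocks₂₁ = Y.toBlocks₂₂ - Y.toBlocks₁₂ :=
    sub_eq_sub_iff_add_eq_add.2 (hY.trans (add_comm _ _))
  have key : (S * (Y.toBlocks₁₁ - Y.toBlocks₂₁) * S')ᵀ = (S * (Y.toBlocks₂₂ - Y.toBlocks₁₂) * S')ᵀ := by rw [h']
  rw [Matrix.mul_sub, Matrix.sub_mul, Matrix.mul_sub, Matrix.sub_mul, transpose_sub, transpose_sub,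
    sub_eq_add_neg, sub_eq_add_neg] at key
  unfold LSum
  rw [← fromBlocks_toBlocks Y]
  simp only [fromBlocks_multiply, fromBlocks_transpose, toBlocks_fromBlocks₁₁, toBlocks_fromBlocks₁₂,
    toBlocks_fromBlocks₂₁, toBlocks_fromBlocks₂₂, Matrix.zero_mul, Matrix.mul_zero, add_zero, zero_add,
    Matrix.neg_mul, Matrix.mul_neg, neg_neg, transpose_neg]
  rw [key, add_comm]

omit [CommRing R] [Fintype ι] [DecidableEq ι] in
/-- bookkeeping (`reindex_symm_reindex`). [folklore] -/
private theorem reindex_symm_reindex {m : Type*} (e : ι ⊕ ι ≃ m) (M : Matrix (ι ⊕ ι) (ι ⊕ ι) R) :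
    Matrix.reindex e.symm e.symm (Matrix.reindex e e M) = M := by
  simp

omit [DecidableEq ι] in
/-- bookkeeping (`reindex_symm_mul`). [folklore] -/
private theorem reindex_symm_mul {m : Type*} [Fintype m] (e : ι ⊕ ι ≃ m) (A B : Matrix m m R) :
    Matrix.reindex e.symm e.symm (A * B) = Matrix.reindex e.symm e.symm A * Matrix.reindex e.symm e.symm B := by
  rw [Matrix.reindex_apply, Matrix.reindex_apply, Matrix.reindex_apply, Equiv.symm_symm, Matrix.submatrix_mul_equiv]

omit [DecidableEq ι] in
/-- bookkeeping (`reindex_mul`). [folklore] -/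
private theorem reindex_mul {m : Type*} [Fintype m] (e : ι ⊕ ι ≃ m) (A B : Matrix (ι ⊕ ι) (ι ⊕ ι) R) :
    Matrix.reindex e e (A * B) = Matrix.reindex e e A * Matrix.reindex e e B := by
  rw [Matrix.reindex_apply, Matrix.reindex_apply, Matrix.reindex_apply, Matrix.submatrix_mul_equiv]

/-- **the `c⁻¹ w`-component at a split place lies in `P_Δ` when the `w`-component does**: for `J = reindex e e (S ⊕ −S)`
with `S` invertible, `g ∈ P_Δ ⇒ ((J g J⁻¹)⁻¹)ᵀ ∈ P_Δ` (the shape of the `c⁻¹w`-component of a point of `U(J)` at a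
split place, `UnitaryGroupSplitPlace`). [cite: HarrisKudlaSweet1996, §1 (1.11)] [cite: Mok2014, §1 Notation p. 5] -/
theorem isSiegelReindex_contragredient_conj {m : Type*} [Fintype m] [DecidableEq m] (e : ι ⊕ ι ≃ m)
    {S : Matrix ι ι R} (hS : IsUnit S.det) (J : GL m R)
    (hJ : (J : Matrix m m R) = Matrix.reindex e e (fromBlocks S 0 0 (-S))) {g : GL m R}
    (hg : DoubledUnitary.IsSiegelReindex e g) :
    DoubledUnitary.IsSiegelReindex e (GLn.contragredient (J * g * J⁻¹)) := by
  -- `g⁻¹ ∈ P_Δ`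
  have hinv : LSum (Matrix.reindex e.symm e.symm ((g⁻¹ : GL m R) : Matrix m m R)) := by
    refine LSum.of_mul_eq_one ?_ hg
    rw [← reindex_symm_mul, ← Units.val_mul, mul_inv_cancel, Units.val_one, Matrix.reindex_apply,
      Matrix.submatrix_one_equiv]
  -- the matrix of `J⁻¹`
  have hJinv : ((J⁻¹ : GL m R) : Matrix m m R) = Matrix.reindex e e (fromBlocks S⁻¹ 0 0 (-S⁻¹)) := by
    rw [Matrix.coe_units_inv, hJ]
    refine Matrix.inv_eq_right_inv ?_
    rw [← reindex_mul, fromBlocks_multiply]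
    simp [Matrix.mul_nonsing_inv _ hS, Matrix.fromBlocks_one, Matrix.submatrix_one_equiv]
  -- the matrix of `((J g J⁻¹)⁻¹)ᵀ`
  have hmat : ((GLn.contragredient (J * g * J⁻¹) : GL m R) : Matrix m m R) =
      ((J : Matrix m m R) * ((g⁻¹ : GL m R) : Matrix m m R) * ((J⁻¹ : GL m R) : Matrix m m R))ᵀ := by
    rw [GLn.coe_contragredient, show (J * g * J⁻¹)⁻¹ = J * g⁻¹ * J⁻¹ by
      rw [_root_.mul_inv_rev, _root_.mul_inv_rev, inv_inv, mul_assoc], Units.val_mul, Units.val_mul]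
  show LSum (Matrix.reindex e.symm e.symm ((GLn.contragredient (J * g * J⁻¹) : GL m R) : Matrix m m R))
  rw [hmat, hJ, hJinv, Matrix.reindex_apply, ← Matrix.transpose_submatrix, ← Matrix.reindex_apply e.symm e.symm,
    reindex_symm_mul, reindex_symm_mul, reindex_symm_reindex, reindex_symm_reindex]
  exact LSum.transpose_diag_conj S S⁻¹ hinv

end CommRing

/-! ## §B the split engine in `P_Δ` form -/

section Field

variable {K : Type*} [Field K] {ι : Type*} [Fintype ι] [DecidableEq ι] {m : Type*} [Fintype m] [DecidableEq m]
  {A : Type*} [CommGroup A]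

/-- **SPLIT ENGINE, `P_Δ` form**: a homomorphism `GL_m(K) → A` (`A` commutative) trivial on `P_Δ = {g ∣ IsSiegelReindex e g}`
is trivial (at a place of `L⁺` split in `L` the doubled unitary group is `GL_{2n}` and `P_Δ` a proper parabolic).
[cite: GelbartRogawski1991, §3.1 Prop. 3.1.1 p. 455 L1–2] [cite: HarrisKudlaSweet1996, §1 (1.11)] -/
theorem hom_eq_one_of_isSiegelReindex (e : ι ⊕ ι ≃ m) (θ : GL m K →* A)
    (hP : ∀ g : GL m K, DoubledUnitary.IsSiegelReindex e g → θ g = 1) : θ = 1 := by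
  set ψ : GL (ι ⊕ ι) K ≃* GL m K := Units.mapEquiv (Matrix.reindexRingEquiv K e).toMulEquiv with hψ
  set C : GL (ι ⊕ ι) K := ⟨cE₂, cE₁, cE₂_mul_cE₁, cE₁_mul_cE₂⟩ with hC
  have hθ₂ : (θ.comp ψ.toMonoidHom).comp (MulAut.conj C).toMonoidHom = 1 := by
    refine hom_eq_one_of_blockTriangular _ fun b hb => ?_
    show θ (ψ (C * b * C⁻¹)) = 1
    refine hP _ ((DoubledUnitary.isSiegelReindex_mapEquiv_iff e _).2 ?_)
    show LSum ((C * b * C⁻¹ : GL (ι ⊕ ι) K) : Matrix (ι ⊕ ι) (ι ⊕ ι) K)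
    rw [lsum_iff_conj]
    have hc : cE₁ * ((C * b * C⁻¹ : GL (ι ⊕ ι) K) : Matrix (ι ⊕ ι) (ι ⊕ ι) K) * cE₂ = (b : Matrix (ι ⊕ ι) (ι ⊕ ι) K) := by
      simp only [Units.val_mul]
      show cE₁ * (cE₂ * (b : Matrix (ι ⊕ ι) (ι ⊕ ι) K) * cE₁) * cE₂ = (b : Matrix (ι ⊕ ι) (ι ⊕ ι) K)
      rw [Matrix.mul_assoc cE₂, ← Matrix.mul_assoc cE₁ cE₂, cE₁_mul_cE₂, Matrix.one_mul, Matrix.mul_assoc,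
        cE₁_mul_cE₂, Matrix.mul_one]
    rw [hc]
    exact hb
  refine MonoidHom.ext fun x => ?_
  have h := DFunLike.congr_fun hθ₂ (C⁻¹ * ψ.symm x * C)
  simp only [MonoidHom.comp_apply, MulEquiv.coe_toMonoidHom, MulAut.conj_apply, MonoidHom.one_apply] at h
  rwa [show C * (C⁻¹ * ψ.symm x * C) * C⁻¹ = ψ.symm x by group, MulEquiv.apply_symm_apply] at h

end Field


/-! ## §C `1 ∈ P_Δ`; the Siegel condition after a jointly injective family of ring maps -/

section Family

/-- `1 ∈ P_Δ`. [cite: HarrisKudlaSweet1996, §1 (1.11)] -/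
theorem isSiegelReindex_one {R : Type*} [CommRing R] {ι m : Type*} [Fintype ι] [DecidableEq ι] [Fintype m]
    [DecidableEq m] (e' : ι ⊕ ι ≃ m) : DoubledUnitary.IsSiegelReindex e' (1 : GL m R) := by
  show LSum (Matrix.reindex e'.symm e'.symm ((1 : GL m R) : Matrix m m R))
  rw [Units.val_one, Matrix.reindex_apply, Matrix.submatrix_one_equiv, LSum, ← Matrix.fromBlocks_one,
    Matrix.toBlocks_fromBlocks₁₁, Matrix.toBlocks_fromBlocks₁₂, Matrix.toBlocks_fromBlocks₂₁, Matrix.toBlocks_fromBlocks₂₂,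
    add_zero, zero_add]

/-- **componentwise Siegel ⇒ Siegel** for a jointly injective family of ring homomorphisms (the Siegel condition is a
system of linear equations in the entries). [cite: HarrisKudlaSweet1996, §1 (1.11)] -/
theorem isSiegelReindex_of_map_family {R : Type*} [CommRing R] {W : Type*} {S : W → Type*} [∀ w, CommRing (S w)]
    {ι m : Type*} [Fintype ι] [DecidableEq ι] [Fintype m] [DecidableEq m] (e' : ι ⊕ ι ≃ m)
    (f : ∀ w, R →+* S w) (hf : ∀ x y : R, (∀ w, f w x = f w y) → x = y) {g : GL m R}
    (h : ∀ w, DoubledUnitary.IsSiegelReindex e' (Matrix.GeneralLinearGroup.map (f w) g)) :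
    DoubledUnitary.IsSiegelReindex e' g := by
  show LSum (Matrix.reindex e'.symm e'.symm (g : Matrix m m R))
  unfold LSum
  ext i j
  refine hf _ _ fun w => ?_
  have hw : LSum (Matrix.reindex e'.symm e'.symm ((g : Matrix m m R).map (f w))) := h w
  unfold LSum at hw
  have hw' := congrFun (congrFun hw i) j
  simpa [Matrix.toBlocks₁₁, Matrix.toBlocks₁₂, Matrix.toBlocks₂₁, Matrix.toBlocks₂₂, Matrix.add_apply] using hw'

end Family

end Literature.NumberTheory.Automorphic.DoubledUnitary.GLBlock
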